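import Summits.CriticalPhenomena.PercolationContinuityZ3.Theorems.PercNearOneGluingNoHeavyQuantConvResidueGiantPool
import HarnessLib

/-!
# QUANT lane R8, T-DEC, (II) `ConvClosedTResidue`: THE E-CUT — a factor in GIANT MODE relative to the other factor's bottom makes the
# convolution DEC at every target (criterion E), and DEC at a layer with no charged self-sufficient atom is exactly the giant-pool inequality

builds on p205010 (kernel theorem, internal audit signed; external expert review pending)

Support file (`--supports stmt-CriticalPhenomena-4575`), QUANT lane LEAD seat prim-quant-lead (gen 26), rung R8 of
`run/shared/lean/prim/quant/LADDER.md`.  Memo `run/shared/lean/prim/quant/FOR-PROVERS-CONV-PIECES.md` §1 / LEAD-NOTES-G26 N63 (the "E-cut":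
on the 33 378 exact residue pairs of the ¼-grid census, criterion E on the convolution settles 25 296, including every exactly tight pair).
Theorems only, standard axioms, no sorries.  Generalises census-1 g21's one-head lemmas (`tails_le_head_of_decAtT`,
`lconv_decAtT_oneHead_giantPool`, `…QuantConvResidueGiantPool`) to any law and any floor.

THE STATEMENTS (floor `0 < x < 1`, `u = x/(1−x)`).
* `LawDec.giantPool_of_decAtT_noSelf` — if `μ ∈ 𝒟(T, J)` on `{0..M}` and NO charged position `k ≤ J` is self-sufficient (`μ k ≠ 0 → 2k < T`), then
  `x·μ([0,J]) ≤ (1−x)·μ((J,M])` (all the mass at or below the layer is low mass and can only ride the giants, at rate `u`; weak duality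
  `dual_le_of_decAtT` with price `u` on every low, `1` on every giant and `u·Σ 1/usage` on the uncharged mids, as in census-1's `tails_le_head_of_decAtT`).
* `LawDec.sum_lconv_range_le` — if `supp μ₂ ⊆ [j − J, ∞)` (every charged `b` has `j ≤ J + b`), the convolution's mass at positions `≤ j` is at most
  `μ₁([0,J])` (a cell `(k,b)` with `k > J` sits above `j`).
* **`LawDec.lconv_decAtT_of_giantPool`** — THE E-CUT: `x·μ₁([0,J]) ≤ (1−x)·μ₁((J,M₁])`, `supp μ₂ ⊆ [j−J, ∞)`, `μ₁, μ₂` probability laws on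
  `{0..M₁}`, `{0..M₂}`, `J ≤ M₁`, `j ≤ M₁+M₂` ⟹ `lconv M₁ M₂ μ₁ μ₂ ∈ 𝒟(T, j)` for EVERY target `T` (criterion E: lows `≤ μ₁([0,J])`, giants `≥ μ₁((J,M₁])`).
* **`LawDec.lconv_decAtT_of_giantMode`** — the residue form: `μ₁ ∈ 𝒟(T₁, J)` with no charged self-sufficient atom `≤ J` and `supp μ₂ ⊆ [j−J, ∞)`
  ⟹ `lconv ∈ 𝒟(T, j)` for every `T`; for a 2-low atom `μ₁` with lowest head `h₁` and `μ₂` with lowest charged position `b₀` this is the case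
  `h₁ + b₀ > j` (take `J = j − b₀ < h₁`) — the exactly-tight family of CONV-RESIDUE-G21 §7.

[this work]; census-1 g21 CONV-RESIDUE-G21, lead g26 FOR-PROVERS-CONV-PIECES (this lane).  Nothing here is cited as a published result.  The gluing rows
served [cite: KozmaNitzan2024, Conjecture 3 (p. 15)]; product measure [cite: Grimmett1999, §1.3 p. 10].
-/

noncomputable section

namespace Summit.CriticalPhenomena.PercolationContinuityZ3.Theorems

namespace Quant

open Finset

namespace LawDec

/-! ### (1) DEC with no charged self-sufficient atom at or below the layer = the giant-pool inequality -/

/-- **GIANT POOL FROM DEC.**  `0 < x < 1`, `μ ∈ 𝒟(T, J)` on `{0..M}`, and every charged position `k ≤ J` is a low (`2k < T`).  Then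
`x·Σ_{k ≤ J} μ k ≤ (1−x)·Σ_{J < k ≤ M} μ k`: weak duality with price `x/(1−x)` on the lows, `1` on the giants, and on an (uncharged) mid `k ≤ J` the
sum of `u/usage` over its compatible lows. [this work] -/
theorem giantPool_of_decAtT_noSelf (x T : ℝ) (J M : ℕ) (μ : ℕ → ℝ) (hx0 : 0 < x) (hx1 : x < 1)
    (hdec : DECAtT x T J M μ) (hJM : J ≤ M) (hnoself : ∀ k, k ≤ J → μ k ≠ 0 → 2 * (k : ℝ) < T) :
    x * ∑ k ∈ Finset.range (J + 1), μ k ≤ (1 - x) * ∑ k ∈ Finset.Ico (J + 1) (M + 1), μ k := by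
  classical
  set u : ℝ := x / (1 - x) with hu
  have h1x : 0 < 1 - x := by linarith
  have hu0 : 0 < u := div_pos hx0 h1x
  set β : ℕ → ℝ := fun k => if J + 1 ≤ k then 1 else
    u * ∑ l ∈ Finset.range (J + 1), (if 2 * (l : ℝ) < T ∧ T < (l : ℝ) + k then 1 / usage x T J l k else 0) with hβ
  have hβ0 : ∀ k, 0 ≤ β k := by
    intro k; simp only [hβ]
    split_ifs
    · exact zero_le_one
    · refine mul_nonneg hu0.le (Finset.sum_nonneg fun l _ => ?_)
      split_ifs with hc
      · have hlk : l < k := by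
          have : (l : ℝ) < k := by linarith [hc.1, hc.2]
          exact_mod_cast this
        exact (one_div_pos.2 (usage_pos_of_compat x T J l k hx0 hx1 hc.1 hlk (Or.inr hc.2))).le
      · exact le_rfl
  have hαβ : ∀ l k, l ≤ J → 2 * (l : ℝ) < T → k ≤ M → (J + 1 ≤ k ∨ T < (l : ℝ) + k) → u ≤ usage x T J l k * β k := by
    intro l k hlJ hlow _ hc
    simp only [hβ]
    by_cases hgk : J + 1 ≤ k
    · rw [if_pos hgk, usage_giant_eq x T J l k hgk, mul_one]
    · rw [if_neg hgk]
      have hck : T < (l : ℝ) + k := by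
        rcases hc with h1 | h1
        · exact absurd h1 hgk
        · exact h1
      have hlk : l < k := by
        have : (l : ℝ) < k := by linarith
        exact_mod_cast this
      have hU := usage_pos_of_compat x T J l k hx0 hx1 hlow hlk (Or.inr hck)
      have hterm : 1 / usage x T J l k ≤
          ∑ l' ∈ Finset.range (J + 1), (if 2 * (l' : ℝ) < T ∧ T < (l' : ℝ) + k then 1 / usage x T J l' k else 0) := by
        have hmem : l ∈ Finset.range (J + 1) := Finset.mem_range.2 (Nat.lt_succ_of_le hlJ)
        refine le_trans (le_of_eq ?_) (Finset.single_le_sum (f := fun (l' : ℕ) =>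
          (if 2 * (l' : ℝ) < T ∧ T < (l' : ℝ) + k then 1 / usage x T J l' k else 0)) (fun l' _ => ?_) hmem)
        · rw [if_pos ⟨hlow, hck⟩]
        · split_ifs with hc'
          · have hlk' : l' < k := by
              have : (l' : ℝ) < k := by linarith [hc'.1, hc'.2]
              exact_mod_cast this
            exact (one_div_pos.2 (usage_pos_of_compat x T J l' k hx0 hx1 hc'.1 hlk' (Or.inr hc'.2))).le
          · exact le_rfl
      calc u = usage x T J l k * (u * (1 / usage x T J l k)) := by field_simp
        _ ≤ usage x T J l k * (u * ∑ l' ∈ Finset.range (J + 1),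
              (if 2 * (l' : ℝ) < T ∧ T < (l' : ℝ) + k then 1 / usage x T J l' k else 0)) :=
            mul_le_mul_of_nonneg_left (mul_le_mul_of_nonneg_left hterm hu0.le) hU.le
  have wd := dual_le_of_decAtT x T J M μ hx0 hx1 hdec (fun _ => u) β hβ0 hαβ
  -- left side: every charged `k ≤ J` is a low, so the low sum is the whole mass at or below `J`
  have hL : ∑ l ∈ Finset.range (J + 1), (if 2 * (l : ℝ) < T then u * μ l else 0) = u * ∑ k ∈ Finset.range (J + 1), μ k := by
    rw [Finset.mul_sum]
    refine Finset.sum_congr rfl fun l hl => ?_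
    have hlJ : l ≤ J := Nat.lt_succ_iff.1 (Finset.mem_range.1 hl)
    by_cases hlow : 2 * (l : ℝ) < T
    · rw [if_pos hlow]
    · rw [if_neg hlow]
      by_cases hμ : μ l = 0
      · rw [hμ, mul_zero]
      · exact absurd (hnoself l hlJ hμ) hlow
  -- right side: the charged absorbers are the giants `J < k ≤ M`, priced `1`
  have hR : ∑ k ∈ Finset.range (M + 1), (if k ≤ J ∧ 2 * (k : ℝ) < T then 0 else β k * μ k)
      ≤ ∑ k ∈ Finset.Ico (J + 1) (M + 1), μ k := by
    have hJM' : J + 1 ≤ M + 1 := by omega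
    rw [← Finset.sum_range_add_sum_Ico _ hJM']
    have hz : ∑ k ∈ Finset.range (J + 1), (if k ≤ J ∧ 2 * (k : ℝ) < T then 0 else β k * μ k) = 0 := by
      refine Finset.sum_eq_zero fun k hk => ?_
      have hkJ : k ≤ J := Nat.lt_succ_iff.1 (Finset.mem_range.1 hk)
      by_cases hlow : 2 * (k : ℝ) < T
      · rw [if_pos ⟨hkJ, hlow⟩]
      · rw [if_neg (fun hc => hlow hc.2)]
        by_cases hμ : μ k = 0
        · rw [hμ, mul_zero]
        · exact absurd (hnoself k hkJ hμ) hlow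
    rw [hz, zero_add]
    refine Finset.sum_le_sum fun k hk => ?_
    rw [Finset.mem_Ico] at hk
    have h1 : ¬ (k ≤ J ∧ 2 * (k : ℝ) < T) := fun hc => by omega
    rw [if_neg h1]
    simp only [hβ]
    rw [if_pos hk.1, one_mul]
  rw [hL] at wd
  have key : u * ∑ k ∈ Finset.range (J + 1), μ k ≤ ∑ k ∈ Finset.Ico (J + 1) (M + 1), μ k := wd.trans hR
  rw [hu, div_mul_eq_mul_div, div_le_iff₀ h1x] at key
  linarith

/-! ### (2) Bookkeeping: the convolution's mass at or below `j` when the second factor lives at or above `j − J` -/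

/-- **mass of the convolution at positions `≤ j`**: if every charged `b` of `μ₂` has `j ≤ J + b`, then
`Σ_{h ≤ j} lconv h ≤ Σ_{k ≤ J} μ₁ k` (`μ₁, μ₂ ≥ 0`, `Σ_{b ≤ M₂} μ₂ b = 1`): a cell `(k, b)` with `k > J` sits above `j`. [this work] -/
theorem sum_lconv_range_le (j J M₁ M₂ : ℕ) (μ₁ μ₂ : ℕ → ℝ) (h10 : ∀ k, 0 ≤ μ₁ k) (h20 : ∀ k, 0 ≤ μ₂ k)
    (h21 : ∑ b ∈ Finset.range (M₂ + 1), μ₂ b = 1) (hbot : ∀ b, μ₂ b ≠ 0 → j ≤ J + b) :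
    ∑ h ∈ Finset.range (j + 1), lconv M₁ M₂ μ₁ μ₂ h ≤ ∑ k ∈ Finset.range (J + 1), μ₁ k := by
  classical
  -- rewrite the left side as a double sum over cells with the indicator `i + q ≤ j`
  have e1 : ∑ h ∈ Finset.range (j + 1), lconv M₁ M₂ μ₁ μ₂ h
      = ∑ i ∈ Finset.range (M₁ + 1), ∑ q ∈ Finset.range (M₂ + 1), (if i + q ≤ j then μ₁ i * μ₂ q else 0) := by
    simp only [lconv]
    rw [Finset.sum_comm]
    refine Finset.sum_congr rfl fun i _ => ?_
    rw [Finset.sum_comm]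
    refine Finset.sum_congr rfl fun q _ => ?_
    rw [Finset.sum_ite_eq (Finset.range (j + 1)) (i + q)]
    by_cases hle : i + q ≤ j
    · rw [if_pos (Finset.mem_range.2 (Nat.lt_succ_of_le hle)), if_pos hle]
    · rw [if_neg (fun hm => hle (Nat.lt_succ_iff.1 (Finset.mem_range.1 hm))), if_neg hle]
  rw [e1]
  -- each row `i`: zero if `i > J` (every charged cell is above `j`), at most `μ₁ i` otherwise
  have hrow : ∀ i ∈ Finset.range (M₁ + 1),
      ∑ q ∈ Finset.range (M₂ + 1), (if i + q ≤ j then μ₁ i * μ₂ q else 0) ≤ (if i ≤ J then μ₁ i else 0) := by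
    intro i _
    by_cases hiJ : i ≤ J
    · rw [if_pos hiJ]
      calc ∑ q ∈ Finset.range (M₂ + 1), (if i + q ≤ j then μ₁ i * μ₂ q else 0)
          ≤ ∑ q ∈ Finset.range (M₂ + 1), μ₁ i * μ₂ q :=
            Finset.sum_le_sum fun q _ => by
              split_ifs
              · exact le_rfl
              · exact mul_nonneg (h10 i) (h20 q)
        _ = μ₁ i := by rw [← Finset.mul_sum, h21, mul_one]
    · rw [if_neg hiJ]
      refine le_of_eq (Finset.sum_eq_zero fun q _ => ?_)
      by_cases hμ : μ₂ q = 0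
      · rw [hμ, mul_zero, ite_self]
      · have := hbot q hμ
        rw [if_neg (by omega)]
  calc ∑ i ∈ Finset.range (M₁ + 1), ∑ q ∈ Finset.range (M₂ + 1), (if i + q ≤ j then μ₁ i * μ₂ q else 0)
      ≤ ∑ i ∈ Finset.range (M₁ + 1), (if i ≤ J then μ₁ i else 0) := Finset.sum_le_sum hrow
    _ = ∑ i ∈ (Finset.range (M₁ + 1)).filter (fun i => i ≤ J), μ₁ i := by rw [Finset.sum_filter]
    _ ≤ ∑ k ∈ Finset.range (J + 1), μ₁ k := by
        refine Finset.sum_le_sum_of_subset_of_nonneg (fun i hi => ?_) (fun k _ _ => h10 k)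
        rw [Finset.mem_filter] at hi
        exact Finset.mem_range.2 (Nat.lt_succ_of_le hi.2)

/-! ### (3) The E-cut -/

/-- **THE E-CUT.**  `0 < x < 1`; probability laws `μ₁` on `{0..M₁}` and `μ₂` on `{0..M₂}` (`μ₂` need not vanish above `M₂` — `lconv` only
reads `{0..M₂}` — but its charged positions `b ≤ M₂` satisfy `j ≤ J + b`); `J ≤ M₁`, `j ≤ M₁ + M₂`; and the GIANT-POOL inequality for `μ₁` at level `J`:
`x·Σ_{k ≤ J} μ₁ k ≤ (1−x)·Σ_{J < k ≤ M₁} μ₁ k`.  Then `lconv M₁ M₂ μ₁ μ₂ ∈ 𝒟(T, j)` for every target `T`, by criterion E: the convolution's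
lows weigh at most its mass at positions `≤ j`, which is `≤ μ₁([0,J])`, and its giants weigh `≥ 1 − μ₁([0,J]) ≥ μ₁((J,M₁])`. [this work] -/
theorem lconv_decAtT_of_giantPool (x T : ℝ) (j J M₁ M₂ : ℕ) (μ₁ μ₂ : ℕ → ℝ) (hx0 : 0 < x) (hx1 : x < 1)
    (h10 : ∀ k, 0 ≤ μ₁ k) (h11 : ∑ k ∈ Finset.range (M₁ + 1), μ₁ k = 1)
    (h20 : ∀ k, 0 ≤ μ₂ k) (h21 : ∑ k ∈ Finset.range (M₂ + 1), μ₂ k = 1)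
    (hj : j ≤ M₁ + M₂) (hJM : J ≤ M₁) (hbot : ∀ b, μ₂ b ≠ 0 → j ≤ J + b)
    (hpool : x * ∑ k ∈ Finset.range (J + 1), μ₁ k ≤ (1 - x) * ∑ k ∈ Finset.Ico (J + 1) (M₁ + 1), μ₁ k) :
    DECAtT x T j (M₁ + M₂) (lconv M₁ M₂ μ₁ μ₂) := by
  classical
  have h1x : 0 < 1 - x := by linarith
  set P : ℝ := ∑ k ∈ Finset.range (J + 1), μ₁ k with hP
  -- the giants of μ₁ weigh exactly `1 − P`
  have hG1 : ∑ k ∈ Finset.Ico (J + 1) (M₁ + 1), μ₁ k ≤ 1 - P := by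
    have hJM' : J + 1 ≤ M₁ + 1 := by omega
    have hsplit := Finset.sum_range_add_sum_Ico μ₁ hJM'
    rw [h11] at hsplit
    linarith
  -- mass of the convolution at or below `j`, and above `j`
  have hlowle : ∑ h ∈ Finset.range (j + 1), lconv M₁ M₂ μ₁ μ₂ h ≤ P :=
    sum_lconv_range_le j J M₁ M₂ μ₁ μ₂ h10 h20 h21 hbot
  have hν0 : ∀ k, 0 ≤ lconv M₁ M₂ μ₁ μ₂ k := lconv_nonneg M₁ M₂ μ₁ μ₂ h10 h20
  have hνsum := sum_lconv M₁ M₂ μ₁ μ₂ h11 h21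
  have hgiant : 1 - P ≤ ∑ k ∈ Finset.Ico (j + 1) (M₁ + M₂ + 1), lconv M₁ M₂ μ₁ μ₂ k := by
    have hjM : j + 1 ≤ M₁ + M₂ + 1 := by omega
    have hsplit := Finset.sum_range_add_sum_Ico (fun k => lconv M₁ M₂ μ₁ μ₂ k) hjM
    rw [hνsum] at hsplit
    linarith
  -- criterion E
  have hE : x * ∑ l ∈ Finset.range (j + 1), (if 2 * (l : ℝ) < T then lconv M₁ M₂ μ₁ μ₂ l else 0)
      ≤ (1 - x) * ∑ k ∈ Finset.Ico (j + 1) (M₁ + M₂ + 1), lconv M₁ M₂ μ₁ μ₂ k := by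
    have s1 : ∑ l ∈ Finset.range (j + 1), (if 2 * (l : ℝ) < T then lconv M₁ M₂ μ₁ μ₂ l else 0) ≤ P :=
      le_trans (Finset.sum_le_sum fun l _ => by
        split_ifs
        · exact le_rfl
        · exact hν0 l) hlowle
    calc x * ∑ l ∈ Finset.range (j + 1), (if 2 * (l : ℝ) < T then lconv M₁ M₂ μ₁ μ₂ l else 0)
        ≤ x * P := mul_le_mul_of_nonneg_left s1 hx0.le
      _ ≤ (1 - x) * ∑ k ∈ Finset.Ico (J + 1) (M₁ + 1), μ₁ k := hpool
      _ ≤ (1 - x) * (1 - P) := mul_le_mul_of_nonneg_left hG1 h1x.le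
      _ ≤ (1 - x) * ∑ k ∈ Finset.Ico (j + 1) (M₁ + M₂ + 1), lconv M₁ M₂ μ₁ μ₂ k := mul_le_mul_of_nonneg_left hgiant h1x.le
  exact (hdecAtT_of_hflowAtT x T j (M₁ + M₂) _ hx0 hx1 (fun k hk => lconv_eq_zero M₁ M₂ μ₁ μ₂ k hk) hνsum
    (hflowAtT_of_giantsAbsorbLows x T j (M₁ + M₂) _ hx0 hx1 hν0 hE)).decAtT

/-- **THE E-CUT, RESIDUE FORM (a factor in giant mode relative to the other factor's bottom).**  `0 < x < 1`; probability laws `μ₁` on `{0..M₁}`,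
`μ₂` on `{0..M₂}`; a level `J ≤ M₁` with `μ₁ ∈ 𝒟(T₁, J)` and no charged self-sufficient atom of `μ₁` at or below `J` (`k ≤ J`, `μ₁ k ≠ 0` ⟹ `2k < T₁`);
every charged position `b` of `μ₂` has `j ≤ J + b`; `j ≤ M₁ + M₂`.  Then `lconv M₁ M₂ μ₁ μ₂ ∈ 𝒟(T, j)` for every target `T`.  For a 2-low atom `μ₁`
(heads above `J`, tails low) and `b₀ = min supp μ₂` this is the case "lowest head of `μ₁` + `b₀` > `j`". [this work] -/
theorem lconv_decAtT_of_giantMode (x T T₁ : ℝ) (j J M₁ M₂ : ℕ) (μ₁ μ₂ : ℕ → ℝ) (hx0 : 0 < x) (hx1 : x < 1)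
    (h10 : ∀ k, 0 ≤ μ₁ k) (h11 : ∑ k ∈ Finset.range (M₁ + 1), μ₁ k = 1)
    (h20 : ∀ k, 0 ≤ μ₂ k) (h21 : ∑ k ∈ Finset.range (M₂ + 1), μ₂ k = 1)
    (hj : j ≤ M₁ + M₂) (hJM : J ≤ M₁) (hbot : ∀ b, μ₂ b ≠ 0 → j ≤ J + b)
    (hdec : DECAtT x T₁ J M₁ μ₁) (hnoself : ∀ k, k ≤ J → μ₁ k ≠ 0 → 2 * (k : ℝ) < T₁) :
    DECAtT x T j (M₁ + M₂) (lconv M₁ M₂ μ₁ μ₂) :=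
  lconv_decAtT_of_giantPool x T j J M₁ M₂ μ₁ μ₂ hx0 hx1 h10 h11 h20 h21 hj hJM hbot
    (giantPool_of_decAtT_noSelf x T₁ J M₁ μ₁ hx0 hx1 hdec hJM hnoself)

end LawDec

end Quant

end Summit.CriticalPhenomena.PercolationContinuityZ3.Theorems
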